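import Summits.Ventures.PercRepro.GenQLargeCorankBound

/-!
# PercRepro — THEOREM LARGE AT EVERY RANK: the large coranks by counting, for every `q` (night-4, gen 7)

The `(8, 6)` cell's THEOREM LARGE (`lbSum t |G| ≤ Jq M G 6 t`, `GenQLargeCorankBound`) is the instance `q = 6` of one
counting theorem whose only input is the SIZE CHAIN of the core — `f` with «every subset of rank `≤ r` has `≤ f r`
points» for `r < q` (`SizeChain M q f`; the `(8, 6)` core: `fSix = 3, 3, 3, 6, 10, 21`).  For a rank-`q` set `G` with `n`
points and `t ≤ q + 2`: a rank-`q` subset with `j > q` points is a spanning non-basis, so `m(S) ≤ q − 2` and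
`m(S) ≤ μ(j) := max {1 ≤ m ≤ q − 2 : j ≤ m + f(q − m)}` (`mTr_le_muQ`), whence its weight is `≥ LwQ q f t j`
(`weight_ge_LwQ`); the fiber `#{S ∈ R_q(G) : |S| = j}` is `C(n, j)` for `j > f(q − 1)`, at least
`C(n, j) − κ_j·C(n, k)` for `f(q − 2) < j ≤ f(q − 1)` (`k = f(q − 2) + 1`, `κ_j = C(f(q−1), j)/C(f(q−1), k)`: the
non-spanning `j`-subsets lie in the rank-`(q − 1)` flats, every `k`-subset of such a flat has rank `q − 1`, and
`C(s, j)/C(s, k)` is monotone in `s` — `choose_ratio_le_gen`, by `Nat.choose_mul`), `≤ C(n, j)` always and `0` below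
`j = q`.  Hence **`lbSumQ_le_Jq`**: `lbSumQ q f t n ≤ Jq M G q t` with the explicit binomial sum `lbSumQ`.
Nothing depends on `q`: the threshold «`0 ≤ lbSumQ q f t n` from `n ≥ n₀(q, t)`» is the one size-dependent number, a
rational computation per `(q, t, n)` (`q = 6`: `n ≥ 22 / 25`; `q = 7`: `n ≥ 44 / 47`, sheet §61 (d)).
Imports `GenQLargeCorankBound`.
-/
namespace PercRepro.Night4

open Finset ThmH SixFour GenQ PerFlat Star

variable {α : Type} [DecidableEq α] {M : Matroid α} [M.Finite]

/-! ## The size chain -/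

/-- `SizeChain M q f`: every subset of the ground set of rank `≤ r` has `≤ f r` points, for every `r < q`. -/
def SizeChain (M : Matroid α) [M.Finite] (q : ℕ) (f : ℕ → ℕ) : Prop :=
  ∀ X : Finset α, X ⊆ gr M → ∀ r : ℕ, r < q → M.eRk (X : Set α) ≤ (r : ℕ∞) → X.card ≤ f r

omit [DecidableEq α] in
/-- A size chain from flat bounds: `f` monotone and every rank-`r` flat (`r < q`) has `≤ f r` points. -/
theorem sizeChain_of_flats {q : ℕ} {f : ℕ → ℕ} (hmono : Monotone f)
    (hflat : ∀ r : ℕ, r < q → ∀ F ∈ flatsQ M r, F.card ≤ f r) : SizeChain M q f := by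
  intro X hX r hr hrk
  obtain ⟨r', hr'⟩ := exists_eRk_eq_nat (M := M) X
  have hr'r : r' ≤ r := by
    rw [hr'] at hrk
    exact_mod_cast hrk
  have hF := clF_mem_flatsQ (M := M) hr'
  have hsub := subset_clF (M := M) hX
  exact (Finset.card_le_card hsub).trans ((hflat r' (by omega) _ hF).trans (hmono hr'r))

/-- The size chain of the `(8, 6)` core: `3, 3, 3, 6, 10, 21` at `r = 0 … 5`. -/
def fSix (r : ℕ) : ℕ := if r ≤ 2 then 3 else if r = 3 then 6 else if r = 4 then 10 else 21

omit [DecidableEq α] in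
/-- **The size chain of the `(8, 6)` core** from the five hypotheses. -/
theorem sizeChain_six_of_coreHyps (hh : CoreHyps M) : SizeChain M 6 fSix := by
  intro X hX r hr hrk
  have h := card_le_of_eRk_le_core hh hX
  interval_cases r
  · show X.card ≤ 3
    exact card_le_three_of_eRk_le_two' hh.1 hh.2.1 hX (hrk.trans (by norm_num))
  · show X.card ≤ 3
    exact card_le_three_of_eRk_le_two' hh.1 hh.2.1 hX (hrk.trans (by norm_num))
  · show X.card ≤ 3
    exact card_le_three_of_eRk_le_two' hh.1 hh.2.1 hX hrk
  · show X.card ≤ 6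
    exact h.2.2 hrk
  · show X.card ≤ 10
    exact h.2.1 hrk
  · show X.card ≤ 21
    exact h.1 hrk

/-! ## The coloop count by size -/

/-- `μ(j)`: `q` for `j ≤ q` (a basis), else the largest `1 ≤ m ≤ q − 2` with `j ≤ m + f(q − m)` (`0` if none). -/
def muQ (q : ℕ) (f : ℕ → ℕ) (j : ℕ) : ℕ :=
  if j ≤ q then q else ((Finset.Icc 1 (q - 2)).filter (fun m => j ≤ m + f (q - m))).sup id

/-- **`m(S) ≤ μ(|S|)`** for `S ∈ R_q(G)` on a simple matroid with the size chain `f`. -/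
theorem mTr_le_muQ (hs : Simple M) {q : ℕ} {f : ℕ → ℕ} (hf : SizeChain M q f) (hq : 2 ≤ q) {G S : Finset α}
    (hG : G ⊆ gr M) (hS : S ∈ Rq M G q) : mTr M S ≤ muQ q f S.card := by
  have hS' := mem_Rq.1 hS
  have hSg : S ⊆ gr M := hS'.1.trans hG
  have hmq : mTr M S ≤ q := mTr_le_of_eRk_eq hSg hS'.2
  unfold muQ
  split_ifs with hj
  · exact hmq
  · rw [not_le] at hj
    have hm2 := mTr_add_two_le_of_spanning_nonbasis hs hSg hS'.2 (by omega) hj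
    by_cases hm0 : mTr M S = 0
    · rw [hm0]
      exact Nat.zero_le _
    · apply Finset.le_sup (f := id) (b := mTr M S)
      rw [Finset.mem_filter, Finset.mem_Icc]
      refine ⟨⟨by omega, by omega⟩, ?_⟩
      apply card_le_mTr_add_of_flats (q := q) (m := mTr M S) _ hSg hS'.2 rfl
      intro F hF
      have hF' := mem_flatsQ.1 hF
      exact hf F hF'.1 (q - mTr M S) (by omega) (le_of_eq hF'.2.2)

/-- The lower weight at type `t` of a rank-`q` set with `j` points: `(q + 2 − t)/(1 + μ(j)) − (q + 2)/(q + 1)`. -/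
def LwQ (q : ℕ) (f : ℕ → ℕ) (t j : ℕ) : ℚ :=
  ((q : ℚ) + 2 - t) / (1 + (muQ q f j : ℚ)) - ((q : ℚ) + 2) / ((q : ℚ) + 1)

/-- The weight of `S ∈ R_q(G)` is `≥ LwQ q f t |S|` (`t ≤ q + 2`). -/
theorem weight_ge_LwQ (hs : Simple M) {q : ℕ} {f : ℕ → ℕ} (hf : SizeChain M q f) (hq : 2 ≤ q) {G : Finset α}
    (hG : G ⊆ gr M) {t : ℕ} (ht : t ≤ q + 2) {S : Finset α} (hS : S ∈ Rq M G q) :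
    LwQ q f t S.card ≤ ((q : ℚ) + 2 - t) * wInf M S - ((q : ℚ) + 2) / ((q : ℚ) + 1) := by
  have hmu := mTr_le_muQ hs hf hq hG hS
  unfold LwQ wInf
  have hnum : (0 : ℚ) ≤ (q : ℚ) + 2 - t := by
    have : (t : ℚ) ≤ (q : ℚ) + 2 := by exact_mod_cast ht
    linarith
  have hmu' : (mTr M S : ℚ) ≤ muQ q f S.card := by exact_mod_cast hmu
  have hpos : (0 : ℚ) < 1 + (mTr M S : ℚ) := by positivity
  rw [mul_one_div]
  gcongr

/-- `J_t ≥ Σ_{S ∈ R_q(G)} ((q + 2 − t)·w_∞(S) − (q + 2)/(q + 1))`: the demand-free count is `≥ 0`. -/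
theorem Jq_ge_sum_weight_gen (G : Finset α) (q t : ℕ) :
    ∑ S ∈ Rq M G q, (((q : ℚ) + 2 - t) * wInf M S - ((q : ℚ) + 2) / ((q : ℚ) + 1)) ≤ Jq M G q t := by
  unfold Jq
  have h1 : ∑ S ∈ Rq M G q, (((q : ℚ) + 2 - t) * wInf M S - ((q : ℚ) + 2) / ((q : ℚ) + 1)) =
      (∑ S ∈ Rq M G q, ((q : ℚ) + 2 - t) * wInf M S) - (((q : ℚ) + 2) / ((q : ℚ) + 1)) * (Nq M G q : ℚ) := by
    rw [Finset.sum_sub_distrib, Finset.sum_const, nsmul_eq_mul]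
    unfold Nq
    ring
  rw [h1]
  have hDF : (0 : ℚ) ≤ (((q : ℚ) + 2) / ((q : ℚ) + 1)) * (DFq M G q t : ℚ) := by positivity
  linarith

omit [DecidableEq α] in
/-- The sum of the lower weights, fiberwise by size. -/
theorem sum_LwQ_eq_fibers (G : Finset α) (q : ℕ) (f : ℕ → ℕ) (t : ℕ) :
    ∑ S ∈ Rq M G q, LwQ q f t S.card =
      ∑ j ∈ Finset.range (G.card + 1),
        (((Rq M G q).filter (fun S : Finset α => S.card = j)).card : ℚ) * LwQ q f t j := by
  rw [← Finset.sum_fiberwise_of_maps_to (s := Rq M G q) (t := Finset.range (G.card + 1))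
    (g := fun S : Finset α => S.card) (fun S hS => Finset.mem_coe.2 (Finset.mem_range.2
      (Nat.lt_succ_of_le (Finset.card_le_card (mem_Rq.1 hS).1))))]
  apply Finset.sum_congr rfl
  intro j _
  rw [Finset.card_eq_sum_ones, Nat.cast_sum, Finset.sum_mul]
  apply Finset.sum_congr rfl
  intro S hS
  rw [(Finset.mem_filter.1 hS).2]
  push_cast
  ring

/-! ## The fibers -/

omit [DecidableEq α] in
/-- The rank-`q` subsets of `G` with `j` points number at most `C(|G|, j)`. -/
theorem card_filter_Rq_le_choose_gen (G : Finset α) (q j : ℕ) :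
    ((Rq M G q).filter (fun S : Finset α => S.card = j)).card ≤ G.card.choose j := by
  rw [← Finset.card_powersetCard]
  apply Finset.card_le_card
  intro S hS
  rw [Finset.mem_filter] at hS
  exact Finset.mem_powersetCard.2 ⟨(mem_Rq.1 hS.1).1, hS.2⟩

omit [DecidableEq α] in
/-- No rank-`q` subset has fewer than `q` points. -/
theorem card_filter_Rq_eq_zero_of_lt_gen (G : Finset α) {q j : ℕ} (hj : j < q) :
    ((Rq M G q).filter (fun S : Finset α => S.card = j)).card = 0 := by
  rw [Finset.card_eq_zero, Finset.eq_empty_iff_forall_notMem]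
  intro S hS
  rw [Finset.mem_filter] at hS
  have := le_card_of_eRk_eq (mem_Rq.1 hS.1).2
  omega

omit [DecidableEq α] in
/-- Every subset of `G` with more than `f(q − 1)` points spans (`G` of rank `q`, size chain `f`). -/
theorem mem_Rq_of_card_gt {q : ℕ} {f : ℕ → ℕ} (hf : SizeChain M q f) (hq : 1 ≤ q) {G T : Finset α}
    (hG : G ⊆ gr M) (hrG : M.eRk (G : Set α) = (q : ℕ∞)) (hT : T ⊆ G) (hc : f (q - 1) < T.card) :
    T ∈ Rq M G q := by
  refine mem_Rq.2 ⟨hT, le_antisymm ?_ ?_⟩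
  · rw [← hrG]
    exact M.eRk_mono (Finset.coe_subset.2 hT)
  · by_contra hlt
    rw [not_le] at hlt
    have hle : M.eRk (T : Set α) ≤ ((q - 1 : ℕ) : ℕ∞) := by
      obtain ⟨r, hr⟩ := exists_eRk_eq_nat (M := M) T
      rw [hr] at hlt ⊢
      have : r < q := by exact_mod_cast hlt
      exact_mod_cast (show r ≤ q - 1 by omega)
    have := hf T (hT.trans hG) (q - 1) (by omega) hle
    omega

omit [DecidableEq α] in
/-- The rank-`q` subsets of `G` with `j > f(q − 1)` points are all its `j`-subsets. -/
theorem card_filter_Rq_eq_choose_gen {q : ℕ} {f : ℕ → ℕ} (hf : SizeChain M q f) (hq : 1 ≤ q) {G : Finset α}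
    (hG : G ⊆ gr M) (hrG : M.eRk (G : Set α) = (q : ℕ∞)) {j : ℕ} (hj : f (q - 1) < j) :
    ((Rq M G q).filter (fun S : Finset α => S.card = j)).card = G.card.choose j := by
  rw [← Finset.card_powersetCard]
  congr 1
  ext S
  simp only [Finset.mem_filter, Finset.mem_powersetCard]
  constructor
  · rintro ⟨hS, hc⟩
    exact ⟨(mem_Rq.1 hS).1, hc⟩
  · rintro ⟨hS, hc⟩
    exact ⟨mem_Rq_of_card_gt hf hq hG hrG hS (hc ▸ hj), hc⟩

/-- **For `j > f(q − 2)`**: `C(|G|, j) ≤ #{S ∈ R_q(G) : |S| = j} + Σ_{F ∈ flatsQ M (q − 1)} C(|F ∩ G|, j)` — a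
non-spanning `j`-subset has rank exactly `q − 1` and lies in a rank-`(q − 1)` flat. -/
theorem choose_le_card_filter_Rq_add_gen {q : ℕ} {f : ℕ → ℕ} (hf : SizeChain M q f) (hq : 2 ≤ q)
    {G : Finset α} (hG : G ⊆ gr M) (hrG : M.eRk (G : Set α) = (q : ℕ∞)) {j : ℕ} (hj : f (q - 2) < j) :
    G.card.choose j ≤ ((Rq M G q).filter (fun S : Finset α => S.card = j)).card +
      ∑ F ∈ flatsQ M (q - 1), (F ∩ G).card.choose j := by
  have hsplit : G.powersetCard j ⊆ ((Rq M G q).filter (fun S : Finset α => S.card = j)) ∪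
      ((G.powersetCard j).filter (fun A : Finset α => M.eRk (A : Set α) = ((q - 1 : ℕ) : ℕ∞))) := by
    intro A hA
    rw [Finset.mem_union, Finset.mem_filter, Finset.mem_filter]
    have hA' := Finset.mem_powersetCard.1 hA
    obtain ⟨r, hr⟩ := exists_eRk_eq_nat (M := M) A
    have hrq : r ≤ q := by
      have := M.eRk_mono (Finset.coe_subset.2 hA'.1)
      rw [hrG, hr] at this
      exact_mod_cast this
    rcases (show r = q ∨ r = q - 1 ∨ r ≤ q - 2 by omega) with h | h | h
    · left
      exact ⟨mem_Rq.2 ⟨hA'.1, by rw [hr, h]⟩, hA'.2⟩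
    · right
      exact ⟨hA, by rw [hr, h]⟩
    · exfalso
      have := hf A (hA'.1.trans hG) (q - 2) (by omega) (by rw [hr]; exact_mod_cast h)
      omega
  calc G.card.choose j = (G.powersetCard j).card := (Finset.card_powersetCard j G).symm
    _ ≤ (((Rq M G q).filter (fun S : Finset α => S.card = j)) ∪
        ((G.powersetCard j).filter (fun A : Finset α => M.eRk (A : Set α) = ((q - 1 : ℕ) : ℕ∞)))).card :=
        Finset.card_le_card hsplit
    _ ≤ ((Rq M G q).filter (fun S : Finset α => S.card = j)).card +
        ((G.powersetCard j).filter (fun A : Finset α => M.eRk (A : Set α) = ((q - 1 : ℕ) : ℕ∞))).card :=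
        Finset.card_union_le _ _
    _ ≤ ((Rq M G q).filter (fun S : Finset α => S.card = j)).card +
        ∑ F ∈ flatsQ M (q - 1), (F ∩ G).card.choose j := by
        gcongr
        rw [card_rank_eq_eq_sum_flats hG j (q - 1)]
        apply Finset.sum_le_sum
        intro F _
        rw [← Finset.card_powersetCard]
        exact Finset.card_filter_le _ _

/-- **`Σ_{F ∈ flatsQ M (q − 1)} C(|F ∩ G|, k) ≤ C(|G|, k)`** for `k = f(q − 2) + 1`: every `k`-subset of a
rank-`(q − 1)` flat has rank `q − 1`. -/
theorem sum_flats_choose_k_le_gen {q : ℕ} {f : ℕ → ℕ} (hf : SizeChain M q f) (hq : 2 ≤ q) {G : Finset α}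
    (hG : G ⊆ gr M) :
    ∑ F ∈ flatsQ M (q - 1), (F ∩ G).card.choose (f (q - 2) + 1) ≤ G.card.choose (f (q - 2) + 1) := by
  calc ∑ F ∈ flatsQ M (q - 1), (F ∩ G).card.choose (f (q - 2) + 1)
      = ∑ F ∈ flatsQ M (q - 1), (((F ∩ G).powersetCard (f (q - 2) + 1)).filter
          (fun A : Finset α => M.eRk (A : Set α) = ((q - 1 : ℕ) : ℕ∞))).card := by
        apply Finset.sum_congr rfl
        intro F hF
        rw [← Finset.card_powersetCard]
        congr 1
        symm
        apply Finset.filter_true_of_mem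
        intro A hA
        have hA' := Finset.mem_powersetCard.1 hA
        have hF' := mem_flatsQ.1 hF
        have hAg : A ⊆ gr M := hA'.1.trans (Finset.inter_subset_right.trans hG)
        obtain ⟨r, hr⟩ := exists_eRk_eq_nat (M := M) A
        have hr1 : r ≤ q - 1 := by
          have := M.eRk_mono (Finset.coe_subset.2 (hA'.1.trans Finset.inter_subset_left))
          rw [hF'.2.2, hr] at this
          exact_mod_cast this
        have hr1' : q - 1 ≤ r := by
          by_contra hlt
          have := hf A hAg (q - 2) (by omega) (by rw [hr]; exact_mod_cast (show r ≤ q - 2 by omega))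
          omega
        rw [hr]
        congr 1
        omega
    _ = ((G.powersetCard (f (q - 2) + 1)).filter
          (fun A : Finset α => M.eRk (A : Set α) = ((q - 1 : ℕ) : ℕ∞))).card :=
        (card_rank_eq_eq_sum_flats hG (f (q - 2) + 1) (q - 1)).symm
    _ ≤ (G.powersetCard (f (q - 2) + 1)).card := Finset.card_filter_le _ _
    _ = G.card.choose (f (q - 2) + 1) := Finset.card_powersetCard _ G

/-- `C(N, k)·C(s, j) ≤ C(N, j)·C(s, k)` for `s ≤ N` and `k ≤ j`: the ratio `C(s, j)/C(s, k)` is monotone in `s`. -/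
theorem choose_ratio_le_gen {N s j k : ℕ} (hs : s ≤ N) (hkj : k ≤ j) :
    N.choose k * s.choose j ≤ N.choose j * s.choose k := by
  by_cases hjs : s < j
  · rw [Nat.choose_eq_zero_of_lt hjs, mul_zero]
    exact Nat.zero_le _
  · rw [not_lt] at hjs
    have hpos : 0 < j.choose k := Nat.choose_pos hkj
    apply Nat.le_of_mul_le_mul_right _ hpos
    have h1 : s.choose j * j.choose k = s.choose k * (s - k).choose (j - k) := Nat.choose_mul hkj
    have h2 : N.choose j * j.choose k = N.choose k * (N - k).choose (j - k) := Nat.choose_mul hkj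
    calc N.choose k * s.choose j * j.choose k = N.choose k * (s.choose k * (s - k).choose (j - k)) := by
          rw [mul_assoc, h1]
      _ ≤ N.choose k * (s.choose k * (N - k).choose (j - k)) := by
          gcongr
      _ = N.choose j * s.choose k * j.choose k := by
          rw [mul_assoc (N.choose j), mul_comm (s.choose k) (j.choose k), ← mul_assoc (N.choose j), h2]
          ring

/-- **`C(f(q−1), k)·Σ_F C(|F ∩ G|, j) ≤ C(f(q−1), j)·C(|G|, k)`** for `j > f(q − 2)`, `k = f(q − 2) + 1`
(the rank-`(q − 1)` flats have `≤ f(q − 1)` points of `G`). -/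
theorem sum_flats_choose_le_gen {q : ℕ} {f : ℕ → ℕ} (hf : SizeChain M q f) (hq : 2 ≤ q) {G : Finset α}
    (hG : G ⊆ gr M) {j : ℕ} (hj : f (q - 2) < j) :
    (f (q - 1)).choose (f (q - 2) + 1) * ∑ F ∈ flatsQ M (q - 1), (F ∩ G).card.choose j ≤
      (f (q - 1)).choose j * G.card.choose (f (q - 2) + 1) := by
  calc (f (q - 1)).choose (f (q - 2) + 1) * ∑ F ∈ flatsQ M (q - 1), (F ∩ G).card.choose j
      = ∑ F ∈ flatsQ M (q - 1), (f (q - 1)).choose (f (q - 2) + 1) * (F ∩ G).card.choose j :=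
        Finset.mul_sum _ _ _
    _ ≤ ∑ F ∈ flatsQ M (q - 1), (f (q - 1)).choose j * (F ∩ G).card.choose (f (q - 2) + 1) := by
        apply Finset.sum_le_sum
        intro F hF
        have hF' := mem_flatsQ.1 hF
        have hFG : (F ∩ G).card ≤ f (q - 1) := by
          apply hf (F ∩ G) (Finset.inter_subset_right.trans hG) (q - 1) (by omega)
          rw [← hF'.2.2]
          exact M.eRk_mono (Finset.coe_subset.2 Finset.inter_subset_left)
        exact choose_ratio_le_gen hFG (by omega)
    _ = (f (q - 1)).choose j * ∑ F ∈ flatsQ M (q - 1), (F ∩ G).card.choose (f (q - 2) + 1) :=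
        (Finset.mul_sum _ _ _).symm
    _ ≤ (f (q - 1)).choose j * G.card.choose (f (q - 2) + 1) := by
        gcongr
        exact sum_flats_choose_k_le_gen hf hq hG

/-! ## The explicit bound -/

/-- `κ_j = C(f(q−1), j)/C(f(q−1), f(q−2) + 1)`. -/
def kapQ (q : ℕ) (f : ℕ → ℕ) (j : ℕ) : ℚ :=
  ((f (q - 1)).choose j : ℚ) / ((f (q - 1)).choose (f (q - 2) + 1) : ℚ)

/-- The fiber lower bound at size `j`: `0` for `j < q`; `C(n, j)·Lw` for `j > f(q − 1)`;
`max(C(n, j) − κ_j·C(n, k), 0)·Lw` for `f(q − 2) < j ≤ f(q − 1)` when `Lw ≥ 0`; `C(n, j)·min(Lw, 0)` otherwise. -/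
def gLBQ (q : ℕ) (f : ℕ → ℕ) (t n j : ℕ) : ℚ :=
  if j < q then 0
  else if f (q - 1) < j then (n.choose j : ℚ) * LwQ q f t j
  else if f (q - 2) < j ∧ 0 ≤ LwQ q f t j then
    max ((n.choose j : ℚ) - kapQ q f j * (n.choose (f (q - 2) + 1) : ℚ)) 0 * LwQ q f t j
  else (n.choose j : ℚ) * min (LwQ q f t j) 0

/-- The explicit lower bound `lbSumQ q f t n = Σ_{j ≤ n} gLBQ q f t n j`. -/
def lbSumQ (q : ℕ) (f : ℕ → ℕ) (t n : ℕ) : ℚ := ∑ j ∈ Finset.range (n + 1), gLBQ q f t n j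

/-- The fiber lower bound: `gLBQ q f t |G| j ≤ #{S ∈ R_q : |S| = j}·LwQ q f t j`. -/
theorem gLBQ_le_fiber {q : ℕ} {f : ℕ → ℕ} (hf : SizeChain M q f) (hq : 2 ≤ q) {G : Finset α} (hG : G ⊆ gr M)
    (hrG : M.eRk (G : Set α) = (q : ℕ∞)) (t j : ℕ) :
    gLBQ q f t G.card j ≤ (((Rq M G q).filter (fun S : Finset α => S.card = j)).card : ℚ) * LwQ q f t j := by
  unfold gLBQ
  split_ifs with hjq hfj hmid
  · rw [card_filter_Rq_eq_zero_of_lt_gen (M := M) G hjq]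
    simp
  · rw [card_filter_Rq_eq_choose_gen hf (by omega) hG hrG hfj]
  · -- `f(q − 2) < j ≤ f(q − 1)`, `Lw ≥ 0`: the fiber is `≥ max(C(n, j) − κ_j C(n, k), 0)`
    obtain ⟨hj2, hL⟩ := hmid
    rw [not_lt] at hfj
    apply mul_le_mul_of_nonneg_right _ hL
    apply max_le
    · have hA := choose_le_card_filter_Rq_add_gen hf hq hG hrG hj2
      have hB := sum_flats_choose_le_gen hf hq hG hj2
      have hpos : (0 : ℚ) < ((f (q - 1)).choose (f (q - 2) + 1) : ℚ) := by
        have : 0 < (f (q - 1)).choose (f (q - 2) + 1) := Nat.choose_pos (by omega)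
        exact_mod_cast this
      have hA' : (G.card.choose j : ℚ) ≤ (((Rq M G q).filter (fun S : Finset α => S.card = j)).card : ℚ) +
          ((∑ F ∈ flatsQ M (q - 1), (F ∩ G).card.choose j : ℕ) : ℚ) := by exact_mod_cast hA
      have hB' : ((f (q - 1)).choose (f (q - 2) + 1) : ℚ) *
          ((∑ F ∈ flatsQ M (q - 1), (F ∩ G).card.choose j : ℕ) : ℚ) ≤
          ((f (q - 1)).choose j : ℚ) * (G.card.choose (f (q - 2) + 1) : ℚ) := by exact_mod_cast hB
      have hB'' : ((∑ F ∈ flatsQ M (q - 1), (F ∩ G).card.choose j : ℕ) : ℚ) ≤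
          kapQ q f j * (G.card.choose (f (q - 2) + 1) : ℚ) := by
        unfold kapQ
        rw [div_mul_eq_mul_div, le_div_iff₀ hpos]
        linarith
      linarith
    · positivity
  · -- the fiber is `≤ C(n, j)`, the weight `≥ min(Lw, 0)`
    have hc : (((Rq M G q).filter (fun S : Finset α => S.card = j)).card : ℚ) ≤ (G.card.choose j : ℚ) := by
      exact_mod_cast card_filter_Rq_le_choose_gen (M := M) G q j
    have hmin : min (LwQ q f t j) 0 ≤ 0 := min_le_right _ _
    have hmin' : min (LwQ q f t j) 0 ≤ LwQ q f t j := min_le_left _ _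
    have hf0 : (0 : ℚ) ≤ (((Rq M G q).filter (fun S : Finset α => S.card = j)).card : ℚ) := by positivity
    calc (G.card.choose j : ℚ) * min (LwQ q f t j) 0
        ≤ (((Rq M G q).filter (fun S : Finset α => S.card = j)).card : ℚ) * min (LwQ q f t j) 0 :=
          mul_le_mul_of_nonpos_right hc hmin
      _ ≤ (((Rq M G q).filter (fun S : Finset α => S.card = j)).card : ℚ) * LwQ q f t j :=
          mul_le_mul_of_nonneg_left hmin' hf0

/-- **THEOREM LARGE AT EVERY RANK**: `lbSumQ q f t |G| ≤ Jq M G q t` on a rank-`q` set `G` of a simple matroid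
with the size chain `f` (`t ≤ q + 2`). -/
theorem lbSumQ_le_Jq (hs : Simple M) {q : ℕ} {f : ℕ → ℕ} (hf : SizeChain M q f) (hq : 2 ≤ q) {G : Finset α}
    (hG : G ⊆ gr M) (hrG : M.eRk (G : Set α) = (q : ℕ∞)) {t : ℕ} (ht : t ≤ q + 2) :
    lbSumQ q f t G.card ≤ Jq M G q t := by
  calc lbSumQ q f t G.card = ∑ j ∈ Finset.range (G.card + 1), gLBQ q f t G.card j := rfl
    _ ≤ ∑ j ∈ Finset.range (G.card + 1),
        (((Rq M G q).filter (fun S : Finset α => S.card = j)).card : ℚ) * LwQ q f t j :=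
        Finset.sum_le_sum (fun j _ => gLBQ_le_fiber hf hq hG hrG t j)
    _ = ∑ S ∈ Rq M G q, LwQ q f t S.card := (sum_LwQ_eq_fibers G q f t).symm
    _ ≤ ∑ S ∈ Rq M G q, (((q : ℚ) + 2 - t) * wInf M S - ((q : ℚ) + 2) / ((q : ℚ) + 1)) :=
        Finset.sum_le_sum (fun S hS => weight_ge_LwQ hs hf hq hG ht hS)
    _ ≤ Jq M G q t := Jq_ge_sum_weight_gen G q t

/-- **The large coranks at every rank, from the numerics**: `0 ≤ lbSumQ q f t |G|` gives `0 ≤ Jq M G q t`. -/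
theorem jq_nonneg_of_lbSumQ (hs : Simple M) {q : ℕ} {f : ℕ → ℕ} (hf : SizeChain M q f) (hq : 2 ≤ q)
    {G : Finset α} (hG : G ⊆ gr M) (hrG : M.eRk (G : Set α) = (q : ℕ∞)) {t : ℕ} (ht : t ≤ q + 2)
    (hnum : 0 ≤ lbSumQ q f t G.card) : 0 ≤ Jq M G q t :=
  hnum.trans (lbSumQ_le_Jq hs hf hq hG hrG ht)

end PercRepro.Night4
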